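import Summits.BirchSwinnertonDyer.BirchSwinnertonDyer.Theorems.ManinLocalTwoThreeCoprimeTwistTransportThree
import Summits.BirchSwinnertonDyer.BirchSwinnertonDyer.Theorems.ManinLocalTwoThreeCubeLawNoBlindSplit
import Summits.BirchSwinnertonDyer.Rank1Residual.ManinAdditive.CuspidalKummerCubeNoBlindLaws
import HarnessLib
import HarnessLib.Audit.Tags

/-!
# The coprime-isolated SPLIT of the `p = 3` orbit-minimal residual: RES₃′ ⟸ hTors ∧ RES₃♭ (an g20 §4, Theorems half)

Summit `BirchSwinnertonDyer`, route `ManinLocalTwoThree` (cell bsd-f2-manin), crux C3 `ManinPrimeToThreeAtNine`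
(stmt-BirchSwinnertonDyer-22968), line `kato_shift_three` (v9: stub 5 := RES₃♭).  HAND-OVER from the cell typer (gen 12)
to the C3 lead / a p-seat: `Theorems/` is prover-only for the typer seat, and these two edges need E-an-93
(`not_three_dvd_maninConstant_of_coprimeTwistPartner_shortThreeTorsion`, p628287), whose module lies in the route cone —
so they cannot sit in the ManinAdditive leaf.  The leaf side (RES₃♭ `NoRationalThreeTorsionCoprimeIsolatedResidual`,
`…_of_orbitMinimal`, `…_of_coprimeIsolated_of_partnerCertificate`) is appended to
`Summits/BirchSwinnertonDyer/Rank1Residual/ManinAdditive/CuspidalKummerCubeLaws.lean` by the typer.  Both theorems below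
are an g20's §4 statements VERBATIM (HOME/an/Sketch-an-g20.lean 6866045b410cb4f3 :254–291); the first is now a one-line
instantiation of the leaf's route-free split.  Suggested target:
`Theorems/ManinLocalTwoThreeCoprimeIsolatedResidualSplit.lean --supports stmt-BirchSwinnertonDyer-22968 --as helper`
(or append to `Theorems/ManinLocalTwoThreeCoprimeTwistTransportThree.lean`, 178 l.).  LANDED by the C3 lead (p1 gen 5)
with ONE addition (§2): the COMPOSITION of skeleton v10 of `kato_shift_three`, all five stubs BY NAME — F-es-18, E-an-57,
LAW₃♮ `CuspidalKummerCubeExponentLawNonBlind`, NB₃ `NoBlindThreeTorsionOptimal` (typer p632572, the lead's inline statements of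
p631186 named) and RES₃♭ — through the lead's split `LAW₃ ⟸ NB₃ ∧ LAW₃♮` (p631186), an's split `RES₃′ ⟸ E-an-57 ∧ LAW₃ ∧
E-an-58 ∧ RES₃♭` (below) and the v8 composition.  CONDITIONAL edges; nothing about BSD or Manin's conjecture is proved.
-/

set_option autoImplicit false
set_option linter.dupNamespace false

noncomputable section

open scoped MatrixGroups ModularForm Classical NumberField

namespace Summit.BirchSwinnertonDyer.BirchSwinnertonDyer.Theorems

open PowerSeries CongruenceSubgroup WeierstrassCurve IsDedekindDomain IsDedekindDomain.HeightOneSpectrum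
  Rat.HeightOneSpectrum Literature.NumberTheory.Automorphic
  Literature.NumberTheory.EllipticCurves Literature.NumberTheory.EllipticCurves.ModularForms
  Summit.BirchSwinnertonDyer.Rank1Residual.ManinAdditive
  Summit.BirchSwinnertonDyer.Rank1Residual.ManinAdditive.CuspidalKummer
  Summit.BirchSwinnertonDyer.Rank1Residual.ManinAdditive.CuspidalKummerThree

/-- **THE SPLIT (PROVED): RES₃′ ⟸ hTors ∧ RES₃♭.**  Excluded middle on clause 7: a coprime twist partner with a rational
short `3`-torsion point certifies `3 ∤ c(W)` by E-an-93; otherwise RES₃♭ applies verbatim.  (The excluded middle is the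
leaf's `noRationalThreeTorsionOrbitMinimalResidual_of_coprimeIsolated_of_partnerCertificate`; here its certificate
hypothesis is instantiated by E-an-93 and `ManinLocalTwoThree.not_good_and_not_mult_of_sq_dvd_conductorNorm`.) -/
theorem noRationalThreeTorsionOrbitMinimalResidual_of_coprimeIsolated
    (hTors : ∀ (B : WeierstrassCurve ℚ) [B.IsElliptic] [B.IsGloballyMinimal] {M : ℕ} [NeZero M]
      (DB : ModularParametrizationData B M), 9 ∣ M →
      (∀ z ∈ DB.L.lattice, ∃ w ∈ periodLattice DB.f, z = DB.c * w) →
      ∀ X₀ Y₀ : ℚ, IsShortThreeTorsion B DB.c X₀ Y₀ → ¬ (3 : ℤ) ∣ DB.c)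
    (hRes : NoRationalThreeTorsionCoprimeIsolatedResidual) : NoRationalThreeTorsionOrbitMinimalResidual := by
  refine noRationalThreeTorsionOrbitMinimalResidual_of_coprimeIsolated_of_partnerCertificate ?_ hRes
  intro W _ _ N _ D hL h7
  obtain ⟨A, hAe, hAm, N', hN'0, D', q, C, u, X₀, Y₀, hCe, hCm, hopt', hN'N, h9', hqp, hq2, hq3, hqN, hadd, hCW,
    hu, hΔ, hTA⟩ := h7
  haveI := hAe; haveI := hAm; haveI := hN'0; haveI := hCe; haveI := hCm
  haveI : Fact q.Prime := ⟨hqp⟩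
  have hadd' : ¬ W.HasGoodReductionAtPrime q ∧ ¬ W.HasMultiplicativeReductionAtPrime q :=
    not_good_and_not_mult_of_sq_dvd_conductorNorm W hadd
  exact not_three_dvd_maninConstant_of_coprimeTwistPartner_shortThreeTorsion hTors hq2 hq3 D hL D' hN'N h9' hqN
    hopt' hadd' u hu hCW hΔ hTA

/-- **The split BY NAME: E-an-57 → LAW₃ → E-an-58 → RES₃♭ → RES₃′.**  So the v9 skeleton of `kato_shift_three` may
replace `stub_noRationalThreeTorsionOrbitMinimalResidual` (RES₃′) by RES₃♭ with no other change (its stubs 2–3 are E-an-57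
and LAW₃; E-an-58 ⟸ E-an-55 = `ManinThreeKummerCube_holds`).  CONDITIONAL edge; nothing about BSD is proved. -/
theorem noRationalThreeTorsionOrbitMinimalResidual_of_cuspidalKummerCube_of_coprimeIsolated
    (h57 : CuspidalKummerCubeRepresentativeAtNine) (hLaw : CuspidalKummerCubeExponentLaw)
    (h58 : ManinPrimeToThreeOfEtaExponent) (hRes : NoRationalThreeTorsionCoprimeIsolatedResidual) :
    NoRationalThreeTorsionOrbitMinimalResidual :=
  noRationalThreeTorsionOrbitMinimalResidual_of_coprimeIsolated
    (not_three_dvd_maninConstant_of_shortThreeTorsion_forall h57 hLaw h58) hRes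

/-! ## §2 Skeleton v10 of `kato_shift_three`, composed BY NAME (lead p1 gen 5) -/

/-- **C3 `ManinPrimeToThreeAtNine` BY NAME from F-es-18, E-an-57, LAW₃♮, NB₃ and RES₃♭** — the composition of skeleton
v10 of line `kato_shift_three`: `LAW₃ ⟸ NB₃ ∧ LAW₃♮` (lead, p631186), `RES₃′ ⟸ E-an-57 ∧ LAW₃ ∧ E-an-58 ∧ RES₃♭` (an g20,
above; E-an-58 = p3's `ManinPrimeToThreeOfEtaExponent_holds`), then the v8 composition
`maninPrimeToThreeAtNine_of_katoFact_of_namedCubeLaws`.  CONDITIONAL. [cite: Kato2004Asterisque, Thm. 9.7 (p. 189)] -/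
theorem ManinLocalTwoThree.maninPrimeToThreeAtNine_of_katoFact_of_cuspidalKummerCube_of_noBlindLaws_of_coprimeIsolated
    (hK : kato_neron_isIntegral_twistedSymbolSum_of_additive_three_polar)
    (h57 : CuspidalKummerCubeRepresentativeAtNine) (hLaw' : CuspidalKummerCubeExponentLawNonBlind)
    (hNB : NoBlindThreeTorsionOptimal) (hRes : NoRationalThreeTorsionCoprimeIsolatedResidual) :
    Summit.BirchSwinnertonDyer.BirchSwinnertonDyer.Theses.ManinLocalTwoThree.ManinPrimeToThreeAtNine :=
  have hLaw : CuspidalKummerCubeExponentLaw :=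
    ManinLocalTwoThree.cuspidalKummerCubeExponentLaw_of_noBlind_of_nonBlindLaw hNB hLaw'
  ManinLocalTwoThree.maninPrimeToThreeAtNine_of_katoFact_of_namedCubeLaws hK h57 hLaw
    (noRationalThreeTorsionOrbitMinimalResidual_of_cuspidalKummerCube_of_coprimeIsolated h57 hLaw
      ManinLocalTwoThree.ManinPrimeToThreeOfEtaExponent_holds hRes)

end Summit.BirchSwinnertonDyer.BirchSwinnertonDyer.Theorems

end
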